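import Summits.Ventures.PercRepro.RankLevelSetUpSeriesClass

/-! # RankLevelSetUpSeriesClassDual — THE DUAL READING OF THE SERIES-CLASS FAMILIES: COMPLEMENTATION INSIDE `E ∖ P`,
THE DELETION `M ＼ P` AND ITS LEVEL `3` (night-1 g38; dossier §50; on `RankLevelSetUpSeriesClass`)

`D ↦ E' ∖ D` maps the avoid-`b` bi-spanning sets of the contraction at level `k` onto the through-`b` ones at level
`#E' − k` (**`avoidHat_ncard_eq_throughHat_compl`**); a member at level `3` needs `#E' ≥ 6`
(**`six_le_of_mem_hat_three`**). The bi-independent sets of `M` are the bi-spanning sets of `M✶`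
(**`biIndep_eq_biSpan_dual`**); the deletion `M ＼ cl✶ {p}` is coloop-free of nullity `≤ 3`, and its bi-independent
through-`b` / avoid-`b` families are exactly `throughHat` / `avoidHat` (**`throughHat_eq_biIndep_delete`**,
**`avoidHat_eq_biIndep_delete`**), so `g_3 ≤ ḡ_4` for `#E' ≥ 8` is (↑) at level `3` of the deletion
(**`throughHat_three_le_avoidHat_four`**, from `upAt_of_nullity_three`). Every declaration has a docstring;
imports: the cell's own modules and Mathlib only. Axioms: standard. -/

namespace PercRepro

open Set Matroid

variable {α : Type} (N : Matroid α) [N.Finite]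
/-! ## Complementation inside `E ∖ P` and the small cases -/

/-- **Complementation in `E ∖ cl {p}`**: `D ↦ (E ∖ cl {p}) ∖ D` is a bijection from the avoid-`b` bi-spanning
`k`-sets of the contraction onto the through-`b` ones at level `#(E ∖ cl {p}) − k` (`b ∈ E ∖ cl {p}`). -/
lemma avoidHat_ncard_eq_throughHat_compl {p b : α} (hb : b ∈ N.E) (hbP : b ∉ N.closure {p}) {k : ℕ}
    (hk : k ≤ (N.E \ N.closure {p}).ncard) :
    (avoidHat N p b k).ncard = (throughHat N p b ((N.E \ N.closure {p}).ncard - k)).ncard := by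
  have hE'fin : (N.E \ N.closure {p}).Finite := N.ground_finite.subset Set.sdiff_subset
  refine Set.ncard_congr (fun D _ => (N.E \ N.closure {p}) \ D) ?_ ?_ ?_
  · rintro D ⟨hDE, hDk, hbD, hDs, hDc⟩
    refine ⟨Set.sdiff_subset, ?_, ⟨⟨hb, hbP⟩, hbD⟩, hDc, ?_⟩
    · rw [Set.ncard_sdiff hDE (hE'fin.subset hDE), hDk]
    · rw [Set.sdiff_sdiff_cancel_left hDE]; exact hDs
  · rintro D D' ⟨hDE, -⟩ ⟨hD'E, -⟩ h
    have h1 : (N.E \ N.closure {p}) \ ((N.E \ N.closure {p}) \ D) =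
        (N.E \ N.closure {p}) \ ((N.E \ N.closure {p}) \ D') := by rw [h]
    rwa [Set.sdiff_sdiff_cancel_left hDE, Set.sdiff_sdiff_cancel_left hD'E] at h1
  · rintro U ⟨hUE, hUk, hbU, hUs, hUc⟩
    refine ⟨(N.E \ N.closure {p}) \ U, ⟨Set.sdiff_subset, ?_, fun h => h.2 hbU, hUc, ?_⟩,
      Set.sdiff_sdiff_cancel_left hUE⟩
    · rw [Set.ncard_sdiff hUE (hE'fin.subset hUE), hUk]; omega
    · rw [Set.sdiff_sdiff_cancel_left hUE]; exact hUs

/-- A member of `throughHat` or `avoidHat` at level `3` needs `#(E ∖ cl {p}) ≥ 6` when `rk N = 4`: the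
complement together with `p` spans, so it has `≥ 4` elements. -/
lemma six_le_of_mem_hat_three (hr : N.eRank = 4) {p b : α} {U : Set α}
    (hU : U ∈ throughHat N p b 3 ∨ U ∈ avoidHat N p b 3) : 6 ≤ (N.E \ N.closure {p}).ncard := by
  set E' := N.E \ N.closure {p} with hE'
  have hE'fin : E'.Finite := N.ground_finite.subset Set.sdiff_subset
  obtain ⟨hUE, hU3, hUc⟩ : U ⊆ E' ∧ U.ncard = 3 ∧ N.Spanning (insert p (E' \ U)) := by
    rcases hU with ⟨h1, h2, -, -, h5⟩ | ⟨h1, h2, -, -, h5⟩ <;> exact ⟨h1, h2, h5⟩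
  have h1 := eRank_le_encard_of_spanning hUc
  have hfin : (insert p (E' \ U)).Finite := (hE'fin.subset Set.sdiff_subset).insert p
  rw [hr, hfin.encard_eq_coe_toFinset_card, ← Set.ncard_eq_toFinset_card _ hfin] at h1
  have h2 : (insert p (E' \ U)).ncard ≤ (E' \ U).ncard + 1 := Set.ncard_insert_le p _
  have h3 : (E' \ U).ncard = E'.ncard - 3 := by rw [Set.ncard_sdiff hUE (hE'fin.subset hUE), hU3]
  have h4 : (4 : ℕ) ≤ (insert p (E' \ U)).ncard := by exact_mod_cast h1
  omega

/-! ## The dual reading of `biIndep` and the contraction -/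

variable (M : Matroid α) [M.Finite]

omit [M.Finite] in
/-- **The bi-independent sets of `M` are the bi-spanning sets of `M✶`.** -/
lemma biIndep_eq_biSpan_dual (k : ℕ) : biIndep M k = biSpan M✶ k := by
  ext W
  simp only [biIndep, biSpan, Set.mem_setOf_eq, Matroid.dual_ground]
  constructor
  · rintro ⟨hWE, hWk, hWi, hWc⟩
    refine ⟨hWE, hWk, ?_, dual_spanning_compl_of_indep M hWi⟩
    have := dual_spanning_compl_of_indep M hWc
    rwa [Set.sdiff_sdiff_cancel_left hWE] at this
  · rintro ⟨hWE, hWk, hWs, hWc⟩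
    refine ⟨hWE, hWk, indep_of_dual_spanning_compl M hWE hWc, ?_⟩
    refine indep_of_dual_spanning_compl M Set.sdiff_subset ?_
    rwa [Set.sdiff_sdiff_cancel_left hWE]

omit [M.Finite] in
/-- Every element of a coloop-free matroid is a nonloop of the dual (restated on the ground set). -/
lemma dual_isNonloop_of_coloopFree' (hcol : ∀ e, ¬ M.IsColoop e) : ∀ e ∈ M✶.E, M✶.IsNonloop e :=
  fun e he => dual_isNonloop_of_coloopFree M hcol (by rwa [Matroid.dual_ground] at he)

omit [M.Finite] in
/-- **The deletion `M ＼ cl✶ {p}` is coloop-free**: its dual is the contraction `M✶ ／ cl✶ {p}`, whose loops would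
lie in `cl✶ (cl✶ {p}) ∖ cl✶ {p} = ∅`. -/
lemma delete_seriesClass_coloopFree (p : α) : ∀ e, ¬ (M.delete (M✶.closure {p})).IsColoop e := by
  intro e he
  rw [← Matroid.dual_isLoop_iff_isColoop, Matroid.dual_delete, Matroid.contract_isLoop_iff_mem_closure,
    Matroid.closure_closure] at he
  exact he.2 he.1

omit [M.Finite] in
/-- **The dual rank of `M ＼ cl✶ {p}` is at most `rk M✶ − 1`** (`p` a nonloop of `M✶`): a base `B` of
`M✶ ／ cl✶ {p}` gives the independent set `B ∪ {p}` of `M✶`. -/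
lemma eRank_dual_delete_seriesClass_add_one_le {p : α} (hp : M✶.IsNonloop p) :
    (M.delete (M✶.closure {p}))✶.eRank + 1 ≤ M✶.eRank := by
  rw [Matroid.dual_delete]
  obtain ⟨B, hB⟩ := (M✶.contract (M✶.closure {p})).exists_isBase
  rw [← hB.encard_eq_eRank]
  have hpI : M✶.Indep {p} := Matroid.indep_singleton.mpr hp
  have hbasis : M✶.IsBasis {p} (M✶.closure {p}) := hpI.isBasis_closure
  have hBi := (hbasis.contract_indep_iff.mp hB.indep)
  have hpB : p ∉ B := fun h => Set.disjoint_left.mp hBi.2 (M✶.mem_closure_of_mem' rfl hp.mem_ground) h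
  have h1 : (B ∪ {p}).encard = B.encard + 1 := by
    rw [Set.union_singleton, Set.encard_insert_of_notMem hpB]
  rw [← h1]
  exact hBi.1.encard_le_eRank

omit [M.Finite] in
/-- **The contraction reading of the families**: for `X ⊆ E ∖ cl✶ {p}`, `X` spans `M✶ ／ cl✶ {p}` iff `insert p X`
spans `M✶`. -/
lemma contract_seriesClass_spanning_iff (hcol : ∀ e, ¬ M.IsColoop e) {p : α} (hp : p ∈ M.E) {X : Set α}
    (hX : X ⊆ M.E \ M✶.closure {p}) :
    (M✶.contract (M✶.closure {p})).Spanning X ↔ M✶.Spanning (insert p X) := by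
  have hPE : M✶.closure {p} ⊆ M✶.E := M✶.closure_subset_ground _
  have hpnl : M✶.IsNonloop p := dual_isNonloop_of_coloopFree M hcol hp
  have hpP : p ∈ M✶.closure {p} := M✶.mem_closure_of_mem' rfl hpnl.mem_ground
  rw [Matroid.contract_spanning_iff hPE]
  have hdj : Disjoint X (M✶.closure {p}) := by
    rw [Set.disjoint_left]; intro x hx hxP; exact (hX hx).2 hxP
  rw [and_iff_left hdj]
  exact spanning_union_iff_insert M✶ (dual_isNonloop_of_coloopFree' M hcol) hpnl (subset_refl _) ⟨p, hpP⟩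
    (hX.trans Set.sdiff_subset)

omit [M.Finite] in
/-- **`throughHat` is the through-`b` bi-independent family of the deletion `M ＼ cl✶ {p}`.** -/
lemma throughHat_eq_biIndep_delete (hcol : ∀ e, ¬ M.IsColoop e) {p : α} (hp : p ∈ M.E) (b : α) (k : ℕ) :
    throughHat M✶ p b k = {U ∈ biIndep (M.delete (M✶.closure {p})) k | b ∈ U} := by
  ext U
  rw [biIndep_eq_biSpan_dual, Matroid.dual_delete]
  simp only [throughHat, biSpan, Set.mem_setOf_eq, Matroid.contract_ground, Matroid.dual_ground]
  constructor
  · rintro ⟨hUE, hUk, hbU, hUs, hUc⟩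
    exact ⟨⟨hUE, hUk, (contract_seriesClass_spanning_iff M hcol hp hUE).mpr hUs,
      (contract_seriesClass_spanning_iff M hcol hp Set.sdiff_subset).mpr hUc⟩, hbU⟩
  · rintro ⟨⟨hUE, hUk, hUs, hUc⟩, hbU⟩
    exact ⟨hUE, hUk, hbU, (contract_seriesClass_spanning_iff M hcol hp hUE).mp hUs,
      (contract_seriesClass_spanning_iff M hcol hp Set.sdiff_subset).mp hUc⟩

omit [M.Finite] in
/-- **`avoidHat` is the avoid-`b` bi-independent family of the deletion `M ＼ cl✶ {p}`.** -/
lemma avoidHat_eq_biIndep_delete (hcol : ∀ e, ¬ M.IsColoop e) {p : α} (hp : p ∈ M.E) (b : α) (k : ℕ) :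
    avoidHat M✶ p b k = {U ∈ biIndep (M.delete (M✶.closure {p})) k | b ∉ U} := by
  ext U
  rw [biIndep_eq_biSpan_dual, Matroid.dual_delete]
  simp only [avoidHat, biSpan, Set.mem_setOf_eq, Matroid.contract_ground, Matroid.dual_ground]
  constructor
  · rintro ⟨hUE, hUk, hbU, hUs, hUc⟩
    exact ⟨⟨hUE, hUk, (contract_seriesClass_spanning_iff M hcol hp hUE).mpr hUs,
      (contract_seriesClass_spanning_iff M hcol hp Set.sdiff_subset).mpr hUc⟩, hbU⟩
  · rintro ⟨⟨hUE, hUk, hUs, hUc⟩, hbU⟩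
    exact ⟨hUE, hUk, hbU, (contract_seriesClass_spanning_iff M hcol hp hUE).mp hUs,
      (contract_seriesClass_spanning_iff M hcol hp Set.sdiff_subset).mp hUc⟩

/-- **`g_3 ≤ ḡ_4` when `#(E ∖ cl✶ {p}) ≥ 8`**: (↑) at level `3` of the coloop-free nullity-`3` deletion
`M ＼ cl✶ {p}` (`upAt_of_nullity_three`). -/
lemma throughHat_three_le_avoidHat_four (hcol : ∀ e, ¬ M.IsColoop e) (hν : M✶.eRank = 4) {p : α}
    (hp : p ∈ M.E) {b : α} (hb : b ∈ M.E) (hbP : b ∉ M✶.closure {p}) (h8 : 8 ≤ (M.E \ M✶.closure {p}).ncard) :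
    (throughHat M✶ p b 3).ncard ≤ (avoidHat M✶ p b 4).ncard := by
  rw [throughHat_eq_biIndep_delete M hcol hp, avoidHat_eq_biIndep_delete M hcol hp]
  have hpnl : M✶.IsNonloop p := dual_isNonloop_of_coloopFree M hcol hp
  have hr : (M.delete (M✶.closure {p}))✶.eRank ≤ 3 := by
    have := eRank_dual_delete_seriesClass_add_one_le M hpnl
    rw [hν] at this
    have h3 : (3 : ℕ∞) + 1 = 4 := by norm_num
    rw [← h3] at this
    exact (WithTop.add_le_add_iff_right (by decide)).mp this
  have hbE : b ∈ (M.delete (M✶.closure {p})).E := ⟨hb, hbP⟩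
  have hn : 2 * 3 + 2 ≤ (M.delete (M✶.closure {p})).E.ncard := by
    rw [Matroid.delete_ground]; exact h8
  exact upAt_of_nullity_three (M.delete (M✶.closure {p})) (delete_seriesClass_coloopFree M p) hr hbE (by norm_num) hn

end PercRepro
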